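import Mathlib
import Summits.MatrixMultiplication.MatrixMultiplication.Theorems.LevelGradedCohnUmansLevelOneGL2DesignsParabolaLiftSqDiffFree
import Summits.MatrixMultiplication.MatrixMultiplication.Theorems.LevelGradedCohnUmansLevelOneGL2DesignsParabolaLiftRuzsa

/-!
# Parabola lift, IV: tangency sets of size `c·p^{6/5}` in `AG(2,p)` for every prime `p`

Wall-breaker axis *parabola lifts over finite fields*, stub `stub_tangencySets` of the crux
`LevelOneGL2Designs` (stmt-MatrixMultiplication-14080, route `LevelGradedCohnUmans`).

Assembly of the integer parabola lift (`ruzsa_lift`, file `…ParabolaLiftRuzsa.lean`) with the base-25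
square-difference-free sets (`exists_sqDiffFree_digits`, file `…ParabolaLiftSqDiffFree.lean`):
for a prime `p` put `n = ⌊p/2⌋`, `M = ⌊√n⌋`, `25^k ≤ n < 25^{k+1}`, `N = 25^k`, `A = A_k`
(`|A| = 10^k`).  Then `N + M² ≤ p`, the lift gives `10^k·M` flags, and
`p ≤ 50·25^k`, `p ≤ 8M²`, `(25^k)^7 ≤ (10^k)^{10}` (as `25^7 ≤ 10^{10}`) combine to
`p^{12} ≤ 50^7·8^5·(10^k M)^{10}` (`tangencySets_pow_bound`), i.e. `|S| ≥ c·p^{6/5}` with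
`c = (50^7·8^5)^{-1/10}` (`tangencySets_six_fifths`).

What this says about the stub.  `stub_tangencySets` asks for exponent `3/2` along infinitely many
primes.  The integer lift gives `|A|·M` with `M ≤ √p` and `A ⊆ [0,p)` square-difference-free, so
exponent `3/2` would need `|A| ≥ c·p`, contradicting Sárközy's theorem (`s(N) = o(N)`); with the best
known sets (Lewko, `s(N) ≥ N^{0.7334}`) it gives `p^{1.2334}` [HPVZ2026, Thm. 1.2], and `6/5` with the
elementary base-25 set used here.  Hunter–Pohoata–Verstraëte–Zhang conjecture (Conj. 10.2) that
`IM(2,p) ≤ p^{3/2-c}` for all large primes, i.e. that the stub is false; either way the parabola-lift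
axis cannot decide it.

Reference: Z. Hunter, C. Pohoata, J. Verstraëte, S. Zhang, *Large point-line matchings and small
Nikodym sets*, arXiv:2601.19879 (2026) (bib `HunterPohoataVerstraeteZhang2026`).
-/

set_option linter.dupNamespace false

namespace Summit.MatrixMultiplication.MatrixMultiplication.Theorems.LevelOneGL2Designs.ParabolaLift

open Finset

/-- **Tangency sets of polynomial excess over the linear scale, all primes (integer form).**  For every
prime `p` there is a strong representative system `S` of `AG(2,p)` in the format of
`stub_tangencySets` with `p^12 ≤ 50^7·8^5·|S|^10`, i.e. `|S| ≫ p^{6/5}`.  Construction: the integer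
parabola lift `ruzsa_lift` with `N = 25^k ≤ p/2 < 25^{k+1}`, `M = ⌊√(p/2)⌋`, and the base-25
square-difference-free set of size `10^k ≥ (25^k)^{7/10}` of `exists_sqDiffFree_digits`. -/
theorem tangencySets_pow_bound (p : ℕ) (hp : p.Prime) :
    ∃ S : Finset ((Fin 2 → ZMod p) × (Fin 2 → ZMod p)),
      p ^ 12 ≤ (50 ^ 7 * 8 ^ 5) * S.card ^ 10 ∧
      ∀ f ∈ S, ∀ f' ∈ S, (dotProduct f.1 f'.2 = 1 ↔ f = f') := by
  haveI : Fact p.Prime := ⟨hp⟩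
  have hp2 : 2 ≤ p := hp.two_le
  -- parameters
  set n : ℕ := p / 2 with hn
  have hn0 : n ≠ 0 := by omega
  set M : ℕ := Nat.sqrt n with hM
  set k : ℕ := Nat.log 25 n with hk
  have hMsq : M ^ 2 ≤ n := Nat.sqrt_le' n
  have hMlt : n < (M + 1) ^ 2 := Nat.lt_succ_sqrt' n
  have hX : 25 ^ k ≤ n := Nat.pow_log_le_self 25 hn0
  have hXlt : n < 25 ^ (k + 1) := Nat.lt_pow_succ_log_self (by norm_num) n
  -- the square-difference-free set and the lift
  obtain ⟨A, hAlt, hAcard, hAfree⟩ := exists_sqDiffFree_digits k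
  have hNM : 25 ^ k + M ^ 2 ≤ p := by omega
  obtain ⟨S, hScard, hS⟩ := ruzsa_lift (p := p) (25 ^ k) M hNM A hAlt hAfree
  refine ⟨S, ?_, hS⟩
  rw [hScard, hAcard]
  -- integer bookkeeping
  have hM1 : 1 ≤ M := by
    rw [hM, Nat.succ_le_iff, Nat.sqrt_pos]
    omega
  have h1 : p ≤ 50 * 25 ^ k := by
    rw [pow_succ] at hXlt
    omega
  have h2 : p ≤ 8 * M ^ 2 := by
    have hMM : M ≤ M ^ 2 := by nlinarith
    have : (M + 1) ^ 2 = M ^ 2 + 2 * M + 1 := by ring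
    omega
  have h3 : (25 ^ k) ^ 7 ≤ (10 ^ k) ^ 10 := by
    calc (25 ^ k) ^ 7 = (25 ^ 7) ^ k := by rw [← pow_mul, ← pow_mul, mul_comm]
      _ ≤ (10 ^ 10) ^ k := Nat.pow_le_pow_left (by norm_num) k
      _ = (10 ^ k) ^ 10 := by rw [← pow_mul, ← pow_mul, mul_comm]
  calc p ^ 12 = p ^ 7 * p ^ 5 := by ring
    _ ≤ (50 * 25 ^ k) ^ 7 * (8 * M ^ 2) ^ 5 :=
        Nat.mul_le_mul (Nat.pow_le_pow_left h1 7) (Nat.pow_le_pow_left h2 5)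
    _ = 50 ^ 7 * 8 ^ 5 * ((25 ^ k) ^ 7 * M ^ 10) := by ring
    _ ≤ 50 ^ 7 * 8 ^ 5 * ((10 ^ k) ^ 10 * M ^ 10) := by gcongr
    _ = 50 ^ 7 * 8 ^ 5 * (10 ^ k * M) ^ 10 := by ring

/-- **Tangency sets of size `c·p^{6/5}` in `AG(2,p)` for EVERY prime `p`** — the unconditional output
of the axis *parabola lifts* for `stub_tangencySets` (whose `p^{3/2}` it does not reach): there is an
absolute `c > 0` such that for every prime `p` some `S ⊆ 𝔽_p² × 𝔽_p²` with `|S| ≥ c·p^{6/5}` satisfies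
`a_f ⬝ᵥ b_{f'} = 1 ↔ f = f'` (an induced matching of points and origin-avoiding lines).  Previously
formalised constructions were linear in `p`; Hunter–Pohoata–Verstraëte–Zhang (2026, Thm. 1.2) reach
`p^{1.2334}` with Lewko's base-205 digit set in place of our base-25 one.
[cite: HunterPohoataVerstraeteZhang2026, Thm. 1.2 and Prop. 2.3 (weaker exponent 6/5)] -/
theorem tangencySets_six_fifths :
    ∃ c : ℝ, 0 < c ∧ ∀ p : ℕ, p.Prime →
      ∃ S : Finset ((Fin 2 → ZMod p) × (Fin 2 → ZMod p)),
        c * (p : ℝ) ^ (6 / 5 : ℝ) ≤ S.card ∧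
        ∀ f ∈ S, ∀ f' ∈ S, (dotProduct f.1 f'.2 = 1 ↔ f = f') := by
  set C : ℝ := ((50 ^ 7 * 8 ^ 5 : ℕ) : ℝ) with hC
  have hC0 : 0 < C := by rw [hC]; positivity
  refine ⟨(C ^ (1 / 10 : ℝ))⁻¹, by positivity, fun p hp => ?_⟩
  obtain ⟨S, hbound, hS⟩ := tangencySets_pow_bound p hp
  refine ⟨S, ?_, hS⟩
  have hp0 : (0 : ℝ) ≤ p := Nat.cast_nonneg p
  have hs0 : (0 : ℝ) ≤ S.card := Nat.cast_nonneg _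
  -- real form of the integer bound
  have hR : (p : ℝ) ^ 12 ≤ C * (S.card : ℝ) ^ 10 := by
    rw [hC]; exact_mod_cast hbound
  -- take `10`-th roots
  have hroot : ((p : ℝ) ^ 12) ^ (1 / 10 : ℝ) ≤ (C * (S.card : ℝ) ^ 10) ^ (1 / 10 : ℝ) :=
    Real.rpow_le_rpow (by positivity) hR (by norm_num)
  have hleft : ((p : ℝ) ^ 12) ^ (1 / 10 : ℝ) = (p : ℝ) ^ (6 / 5 : ℝ) := by
    rw [← Real.rpow_natCast, ← Real.rpow_mul hp0]
    norm_num
  have hright : (C * (S.card : ℝ) ^ 10) ^ (1 / 10 : ℝ) = C ^ (1 / 10 : ℝ) * S.card := by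
    rw [Real.mul_rpow hC0.le (by positivity)]
    congr 1
    have := Real.pow_rpow_inv_natCast hs0 (by norm_num : (10 : ℕ) ≠ 0)
    rw [show ((10 : ℕ) : ℝ)⁻¹ = (1 / 10 : ℝ) by norm_num] at this
    exact this
  rw [hleft, hright] at hroot
  have hC10 : 0 < C ^ (1 / 10 : ℝ) := by positivity
  calc (C ^ (1 / 10 : ℝ))⁻¹ * (p : ℝ) ^ (6 / 5 : ℝ)
      ≤ (C ^ (1 / 10 : ℝ))⁻¹ * (C ^ (1 / 10 : ℝ) * S.card) := by gcongr
    _ = S.card := by field_simp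

end Summit.MatrixMultiplication.MatrixMultiplication.Theorems.LevelOneGL2Designs.ParabolaLift
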